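import Literature.Computability.Complexity.MurrayWilliams2018ExpLevel
import Literature.Computability.Complexity.Williams2014StageAFP
import Literature.Computability.Complexity.SuccinctWitnessesFromUWC
import HarnessLib

/-!
# Murray–Williams' headline `NQP ⊄ ACC⁰` over Williams' PROVED generator: only machine `B` remains

Literature / circuit complexity; serves the named fact
`Literature.Computability.Complexity.MurrayWilliams2018_NQP_not_subset_ACC0 : ¬ (NQP ⊆ ACC0)`
(`CircuitLowerBounds.lean`; C. D. Murray, R. R. Williams, *Circuit lower bounds for
nondeterministic quasi-polytime: an easy witness lemma for NP and NQP*, STOC 2018, §1.1 and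
Thm. 1.3). `MurrayWilliams2018ExpLevel.lean` proves the headline (indeed the printed Theorem 1.3,
`MurrayWilliams2018_NTIME_not_depth_ACC`) from the Easy Witness Lemma 4.1
(`MurrayWilliams2018_lemma_4_1_ae`), Williams' `ACC`-SAT algorithm (`Williams2014_thm_4_1`) and
ONE inline hypothesis, the *exponential-level simulation* `hN`: under an `AC⁰[m]`-SAT algorithm
and QUASI-POLYNOMIAL-size depth-`d` `AC⁰[m]` circuits for `P`, every `L ∈ NTIME(2ⁿ)` with
subexponential witness circuits lies in `NTIME(n + 2ⁿ/n)`. Discharging `hN` means re-running BOTH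
halves of Williams' Theorem 3.2 (J. ACM 2014) — the generator `A` of Lemma 3.1 (at
quasi-polynomial size, because Theorem 1.3 is a statement about `2^{log^k n}`-size circuits) and
the machine `B` (at subexponential witness size) — together with Fact 3.1.

This file observes that for the HEADLINE the generator half is already a theorem of the tree.
The negation of the headline, `NQP ⊆ ACC⁰`, gives `P ⊆ ACC⁰` with POLYNOMIAL size
(`P_subset_NQP`), which is exactly the hypothesis of Williams' Lemma 3.1 in the polynomial form
PROVED in `Williams2014StageAFP.lean` (`Williams2014_lemma_3_1_holds`); the polynomial-size
`AC⁰[m]`-SAT calls of Lemma 3.1 are supplied by Theorem 4.1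
(`Williams2014_accSat_polysize_of_thm_4_1`). Hence, for the headline, the only machine still to
be built is Williams' machine `B` run with SUBEXPONENTIAL succinct witnesses — hypothesis `hB`
below, stated over the tree's own interfaces of the polynomial machine `B`
(`Williams2014_thm_3_2_machineB`, `Williams2014Lemma31.lean`: succinct reductions
`IsSuccinctReduction`, generated clause circuits `NGenerates williamsBound (GoodClauseCircuits …)`,
`accBasis m`-circuits encoding satisfying assignments `Circuit.assignment`, the subexponential
SAT format `AccSatSubexp` of `MurrayWilliams2018.lean`):

* `eventually_poly_two_pow_nthRoot_le` — arithmetic: a polynomial of `2^{⌊n^{1/(2q)}⌋} + O(n)`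
  is eventually `≤ 2^{⌊n^{1/q}⌋}`;
* `exists_subexpAccAssignments_of_hasWitnessCircuits` — **proved**: witness circuits of size
  `2^{⌊n^{1/(2q)}⌋}` for the `2^{n³}`-verifiers of `L` (Murray–Williams' `HasWitnessCircuits`),
  a succinct reduction `cl` of `L` and an `ACC` simulation of unrestricted circuits
  (`AccSimulation m d qS`, Williams 2014, Lemma 5.1, from `P ⊆ ACC0`) give, for EVERY `x ∈ L`,
  an `accBasis m`-circuit of depth `≤ d`, `≤ a · 2^{⌊n^{1/q}⌋} + a` gates and
  `≤ succinctWidth c n` inputs encoding a satisfying assignment of `succinctCNF c cl x` (long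
  inputs: the clause-table verifier `exists_clauseTableVerifier` and the input restriction
  `exists_restrict_inputs` of `SuccinctWitnessesFromUWC.lean`, verbatim as in the tree's proof
  of Williams' Thm. 5.1 from Thm. 5.2; short inputs: any satisfying assignment, realised by
  Shannon expansion `cktSize_univ`, the finitely many sizes absorbed by the constant `a`);
* **`MurrayWilliams2018_NQP_not_subset_ACC0_of_EWL_of_machineB`** — **proved**: the headline
  from (1) the easy witness lemma for `NQP` in level form (`hEWL`, verbatim the hypothesis of
  `MurrayWilliams2018_thm_1_2_acc_of_EWL_of_expSimulation`, supplied from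
  `MurrayWilliams2018_lemma_4_1_ae` by `MurrayWilliams2018_lemma_1_3_of_lemma_4_1_ae`),
  (2) Williams' Fact 3.1 (`Williams2014_fact_3_1`, named fact), (3) the machine `B` at
  subexponential witness size (`hB`, inline hypothesis), (4) Williams' Theorem 4.1
  (`Williams2014_thm_4_1`, named fact). Proof: assume `NQP ⊆ ACC0`; then `P ⊆ ACC0`, whence ONE
  modulus `m ≥ 2`, depth `d` and polynomial `qS` with `AccSimulation m d qS` (Lemma 5.1,
  `exists_accSimulation_of_P_subset_ACC0`); every level `NTIME(n^{(log₂ n)ᵉ}) ⊆ NQP ⊆ ACC0` has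
  unrestricted circuits of size `2^{(log₂ n)⁵}` almost everywhere, so (`hEWL`) witness circuits of
  size `2^{(log₂ n)^K}` at all high levels; take Williams' hard language
  `L₁ ∈ NTIME(2ⁿ) ∖ NTIME(n + 2ⁿ/n)` (PROVED hierarchy, `exists_mem_NTIME_two_pow_not_mem_williamsBound`),
  its succinct reduction `cl` (Fact 3.1), the generator of its clause circuits (Lemma 3.1, PROVED,
  fed by Thm. 4.1 at polynomial size), and let `B` name its witness root `q` (given the
  all-depth `AC⁰[m]`-SAT algorithms of Thm. 4.1, `MurrayWilliams2018_thm_5_1_of_thm_4_1`); pad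
  `L₁` subexponentially into a high level (`padLangQ_mem_NTIME_level`, `MurrayWilliams2018ExpLevel.lean`),
  pull the witness circuits back (`HasWitnessCircuits.of_padLangQ`, size `2^{⌊N^{1/(2q)}⌋}` by
  `eventually_log_padLenQ_pow_le`), convert them into subexponential `ACC` assignments
  (`exists_subexpAccAssignments_of_hasWitnessCircuits`); `B` puts `L₁ ∈ NTIME(n + 2ⁿ/n)` —
  contradiction;
* `MurrayWilliams2018_NQP_not_subset_ACC0_of_lemma_4_1_ae_of_machineB` — the same over the
  named facts `MurrayWilliams2018_lemma_4_1_ae`, `Williams2014_fact_3_1`, `Williams2014_thm_4_1`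
  and `hB` only.

Theorems only: no definition and no named fact is introduced (D-0026). After this file the trust
base of the HEADLINE is `{MurrayWilliams2018_lemma_4_1_ae, Williams2014_fact_3_1,
Williams2014_thm_4_1}` plus the single machine construction `hB` (Williams' `B`, pp. 12–13 of
J. ACM 2014, with the witness circuit `W` of size `a · 2^{⌊n^{1/q}⌋} + a` instead of `nᵉ + e` and
the SAT call made to the `2^{w - ⌊w^{1/r}⌋}`-time algorithm for `2^{⌊w^{1/r}⌋}`-size circuits of
Thm. 5.1 / Thm. 4.1; `B` chooses `q` after the algorithm's `r`, e.g. `q = 2r`). Theorem 1.3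
itself still needs the generator at quasi-polynomial size (`MurrayWilliams2018ExpLevel.lean`).

## Faithfulness notes

* This is the source's own derivation of `NQP ⊄ ACC` (§1.1: "These results readily imply (using
  the existing framework) stronger circuit lower bounds"; §5, proof of Thm. 1.1/1.2: "The proof
  is similar to earlier arguments [Wil10, Wil11, SW13]") run, as in
  `MurrayWilliams2018ExpLevel.lean` (module docstring, "Faithfulness notes"), at the exponential
  level for a subexponentially padded hard language, so that Williams' efficient succinct
  Cook–Levin reduction (Fact 3.1) replaces the PCP of Ben-Sasson–Viola and a DETERMINISTIC
  `AC⁰[m]`-SAT algorithm replaces `GAP UNSAT`; the only difference from that file is that the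
  contradiction is derived from `NQP ⊆ ACC0` (polynomial size) instead of assumption (A) of the
  proof of Thm. 1.2 (quasi-polynomial size), which is what lets the PROVED polynomial Lemma 3.1
  serve. All readings of levels, witness circuits (`HasWitnessCircuits`, eventual in the input
  length), pads and `AccSatSubexp` are those documented there and in
  `MurrayWilliams2018Transfer.lean`.
* `hB` is Williams' machine `B` (J. ACM 2014, proof of Thm. 3.2, pp. 12–13: "`B`
  nondeterministically guesses a `S(3n)`-size circuit `W` … constructs an `ACC` CIRCUIT SAT
  instance `D` to verify that `W` is correct … By assumption, the satisfiability of `D` can be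
  determined in `O(2ⁿ/nᶜ)` time") with the printed `S(3n)`-size witness read as
  `a · 2^{⌊n^{1/q}⌋} + a` gates (Murray–Williams, §5, step 2: "guesses a witness circuit `W_n` of
  size `2^{O(log^{k³} n)}`", which after the pad of `MurrayWilliams2018ExpLevel.lean` is
  `2^{O(N^{1/q})}` in the length `N` of the unpadded input): the instance `D` then has
  `w = n + c log₂ n + c` inputs, constant depth and `2^{O(n^{1/q})} · poly(n)` gates, inside the
  class of the `2^{w - ⌊w^{1/r}⌋}`-time algorithm once `q ≥ 2r` and `n` is large, and
  `2^{w - ⌊w^{1/r}⌋} = O(2ⁿ/n)`; as in the polynomial `Williams2014_thm_3_2_machineB` the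
  witnesses are supplied for every `x ∈ L` (the additive `a` absorbs short inputs) and the SAT
  algorithms for every depth at the modulus `m`.

## References

* C. D. Murray, R. R. Williams, *Circuit lower bounds for nondeterministic quasi-polytime: an
  easy witness lemma for NP and NQP*, Proc. 50th STOC (2018) 890–901, §1.1, Lemma 1.3/4.1, §2
  (witness circuits), Thm. 1.2–1.3 and §5 (proofs), Thm. 5.1 [MurrayWilliams2018].
* R. Williams, *Nonuniform ACC circuit lower bounds*, J. ACM 61(1) (2014) 2:1–2:32, Fact 3.1,
  Lemma 3.1, proof of Thm. 3.2 (machine `B`, pp. 12–13), Thm. 4.1, Lemma 5.1, §5 (Thm. 5.1 from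
  Thm. 5.2), proof of Thm. 1.1 (pp. 17–18) [Williams2014].
* S. Arora, B. Barak, *Computational Complexity: A Modern Approach*, CUP 2009, Claim 2.13
  (every function has a circuit), §2.6.2 (padding), Thm. 3.2 (nondeterministic time hierarchy)
  [AroraBarak2009].
-/

noncomputable section

namespace Literature.Computability.Complexity

open _root_.Computability Turing Filter Asymptotics Polynomial Classes

/-! ### Arithmetic: polynomials of `2^{⌊n^{1/(2q)}⌋}` against `2^{⌊n^{1/q}⌋}` -/

/-- `⌊n^{1/(2q)}⌋² ≤ ⌊n^{1/q}⌋` (`q ≠ 0`). [folklore] -/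
theorem nthRoot_two_mul_sq_le {q : ℕ} (hq : q ≠ 0) (n : ℕ) :
    Nat.nthRoot (2 * q) n * Nat.nthRoot (2 * q) n ≤ Nat.nthRoot q n := by
  rw [Nat.le_nthRoot_iff hq, ← pow_two, ← pow_mul]
  exact Nat.pow_nthRoot_le (Or.inl (by positivity))

/-- **A polynomial of `2^{⌊n^{1/(2q)}⌋} + O(n)` is eventually below `2^{⌊n^{1/q}⌋}`**: for all
`C, D, c` and `q ≥ 1` there is `N` with
`C · (succinctWidth c n + 2^{⌊n^{1/(2q)}⌋} + 2)^D + C ≤ C · 2^{⌊n^{1/q}⌋} + C` for `n ≥ N`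
(`⌊n^{1/(2q)}⌋` outgrows `log₂ n`, `eventually_log_le_nthRoot`, and its square is at most
`⌊n^{1/q}⌋`). The size bookkeeping of subexponential witnesses after an `ACC` simulation of
polynomial cost. [folklore] -/
theorem eventually_poly_two_pow_nthRoot_le (C D c : ℕ) {q : ℕ} (hq : 1 ≤ q) :
    ∃ N : ℕ, ∀ n : ℕ, N ≤ n →
      C * (succinctWidth c n + 2 ^ Nat.nthRoot (2 * q) n + 2) ^ D + C ≤
        C * 2 ^ Nat.nthRoot q n + C := by
  have hq0 : q ≠ 0 := by omega
  have h2q : 2 * q ≠ 0 := by omega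
  obtain ⟨N, hN⟩ := eventually_log_le_nthRoot 1 (c + D + 4) h2q
  refine ⟨N, fun n hn => ?_⟩
  set t := Nat.nthRoot (2 * q) n with ht
  have htN : 1 * Nat.log 2 (n + 1) + (c + D + 4) ≤ t := hN n hn
  -- (a) the linear part fits under `2 ^ t`
  have hlog : n + 1 < 2 ^ (Nat.log 2 (n + 1) + 1) := Nat.lt_pow_succ_log_self one_lt_two _
  have hc2 : c + 1 ≤ 2 ^ c := Nat.lt_two_pow_self
  have hw : succinctWidth c n ≤ (c + 1) * n + c := succinctWidth_le c n
  have hpow : 2 ^ (Nat.log 2 (n + 1) + 1) * 2 ^ (c + 2) ≤ 2 ^ t := by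
    rw [← pow_add]
    exact Nat.pow_le_pow_right two_pos (by omega)
  have hlin : succinctWidth c n + 2 ≤ 2 ^ t := by
    have h1 : (c + 1) * n + c + 2 ≤ (n + 1) * 2 ^ (c + 2) := by
      have : 2 ^ (c + 2) = 2 ^ c * 4 := by rw [pow_add]; norm_num
      rw [this]
      nlinarith [hc2]
    have h2 : (n + 1) * 2 ^ (c + 2) ≤ 2 ^ (Nat.log 2 (n + 1) + 1) * 2 ^ (c + 2) :=
      Nat.mul_le_mul_right _ hlog.le
    omega
  have hbase : succinctWidth c n + 2 ^ t + 2 ≤ 2 ^ (t + 1) := by rw [pow_succ]; omega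
  -- (b) the `D`-th power fits under `2 ^ (t * t) ≤ 2 ^ ⌊n^{1/q}⌋`
  have htD : D + 1 ≤ t := by omega
  have hexp : D * (t + 1) ≤ t * t := by nlinarith
  have hmain : (succinctWidth c n + 2 ^ t + 2) ^ D ≤ 2 ^ Nat.nthRoot q n :=
    calc (succinctWidth c n + 2 ^ t + 2) ^ D ≤ (2 ^ (t + 1)) ^ D := Nat.pow_le_pow_left hbase D
      _ = 2 ^ (D * (t + 1)) := by rw [← pow_mul, mul_comm]
      _ ≤ 2 ^ (t * t) := Nat.pow_le_pow_right two_pos hexp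
      _ ≤ 2 ^ Nat.nthRoot q n := Nat.pow_le_pow_right two_pos (nthRoot_two_mul_sq_le hq0 n)
  exact Nat.add_le_add_right (Nat.mul_le_mul_left C hmain) C

/-! ### Subexponential witness circuits give subexponential `ACC` assignments -/

/-- **Any satisfying assignment is encoded by some `ACC` circuit of controlled shape** (short
inputs). Given an `ACC` simulation `AccSimulation m d qS` (Williams 2014, Lemma 5.1) and a
satisfiable presented formula `succinctCNF c cl x` of a succinct reduction, some circuit over
`accBasis m` with `succinctWidth c |x|` inputs, depth `≤ d` and at most
`qS (w + univBound w)` gates, `w = succinctWidth c |x|`, encodes (`Circuit.assignment`) a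
satisfying assignment: realise the assignment restricted to the variables `< 2ʷ` (the only ones
occurring, `IsSuccinctReduction.var_lt`) by Shannon expansion (`cktSize_univ`, Arora–Barak 2009,
Claim 2.13) and simulate. [cite: AroraBarak2009, Claim 2.13] -/
theorem exists_accAssignment_of_satisfiable {c m d : ℕ} {qS : Polynomial ℕ}
    {L : Language Bool} {cl : List Bool → ℕ → Clause ℕ} (hred : IsSuccinctReduction c L cl)
    (hS : AccSimulation m d qS) {x : List Bool} (hx : (succinctCNF c cl x).Satisfiable) :
    ∃ W : Circuit (Fin (succinctWidth c x.length)), W.IsOver (accBasis m) ∧ W.acDepth ≤ d ∧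
      W.size ≤ qS.eval (succinctWidth c x.length + univBound (succinctWidth c x.length)) ∧
      (succinctCNF c cl x).eval W.assignment = true := by
  obtain ⟨σ, hσ⟩ := hx
  set w := succinctWidth c x.length with hw
  -- Shannon expansion of the table of `σ` below `2 ^ w`
  let g : (Fin w → Bool) → Bool := fun u => σ (MetaComplexity.boolFunEquivFin w u)
  obtain ⟨W₀, hW₀B, hW₀s, hW₀e⟩ := (cktSize_univ fun (u : Fin w → Bool) (_ : Unit) => g u).toCircuit
  rw [Fintype.card_fin] at hW₀s
  -- its `ACC` simulation
  obtain ⟨W, hWB, hWd, hWs, hWe⟩ := hS w W₀ hW₀B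
  refine ⟨W, hWB, hWd, hWs.trans (natPoly_eval_mono qS (Nat.add_le_add_left hW₀s w)), ?_⟩
  rw [eval_succinctCNF_congr hred x (σ := W.assignment) (τ := σ) fun v hv => ?_]
  · exact hσ
  · rw [Circuit.assignment_of_lt W hv, hWe, hW₀e]
    simp [g]

/-- **Subexponential witness circuits give subexponential `ACC` satisfying assignments for every
input.** Let `cl` be a succinct reduction of `L` with constant `c` (Williams 2014, Fact 3.1),
`AccSimulation m d qS` an `ACC` simulation of unrestricted circuits (Lemma 5.1, from `P ⊆ ACC0`),
and suppose `L` has witness circuits of size `2^{⌊n^{1/(2q)}⌋}` for its `2^{n³}`-verifiers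
(Murray–Williams 2018, §2, `HasWitnessCircuits`; `q ≥ 1`). Then there is a constant `a` such that
for EVERY `x ∈ L` some circuit over `accBasis m` with `k ≤ succinctWidth c |x|` inputs, depth
`≤ d` and at most `a · 2^{⌊|x|^{1/q}⌋} + a` gates encodes a satisfying assignment of
`succinctCNF c cl x`. Long inputs: apply the witness circuits to the clause-table verifier
(`exists_clauseTableVerifier`), cut the circuit down to `succinctWidth c n` inputs
(`exists_restrict_inputs`) — verbatim the tree's derivation of Williams' Thm. 5.1 from Thm. 5.2
(`Williams2014_thm_5_1_of_thm_5_2`) — and simulate in `ACC` at polynomial cost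
(`eventually_poly_two_pow_nthRoot_le`); short inputs: `exists_accAssignment_of_satisfiable`, the
finitely many sizes bounded by `a`. [cite: Williams2014, §5 (Thm. 5.1 from Thm. 5.2) and Lemma 5.1] -/
theorem exists_subexpAccAssignments_of_hasWitnessCircuits {c m d q : ℕ} {qS : Polynomial ℕ}
    {L : Language Bool} {cl : List Bool → ℕ → Clause ℕ} (hred : IsSuccinctReduction c L cl)
    (hS : AccSimulation m d qS) (hq : 1 ≤ q)
    (hw : HasWitnessCircuits (fun n => 2 ^ (n ^ 3)) L (fun n => 2 ^ Nat.nthRoot (2 * q) n)) :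
    ∃ a : ℕ, ∀ x ∈ L, ∃ (k : ℕ) (W : Circuit (Fin k)), k ≤ succinctWidth c x.length ∧
      W.IsOver (accBasis m) ∧ W.acDepth ≤ d ∧ W.size ≤ a * 2 ^ Nat.nthRoot q x.length + a ∧
        (succinctCNF c cl x).eval W.assignment = true := by
  -- the clause-table verifier and its witness circuits
  obtain ⟨V, hV⟩ := exists_clauseTableVerifier hred
  obtain ⟨n₀, hn₀⟩ := hw V
  -- the polynomial cost of the simulation and the threshold
  obtain ⟨C, D, hCD⟩ := exists_eval_le_mul_pow_add qS
  obtain ⟨N, hN⟩ := eventually_poly_two_pow_nthRoot_le C D c hq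
  -- the constant for the short inputs
  let F : ℕ → ℕ := fun n => qS.eval (succinctWidth c n + univBound (succinctWidth c n))
  set a₀ := (Finset.range (max n₀ N)).sup F with ha₀
  refine ⟨a₀ + C, fun x hx => ?_⟩
  rcases lt_or_ge x.length (max n₀ N) with hlt | hge
  · -- short input: any satisfying assignment
    obtain ⟨W, hWB, hWd, hWs, hWsat⟩ :=
      exists_accAssignment_of_satisfiable hred hS ((hred.mem_iff x).1 hx)
    refine ⟨succinctWidth c x.length, W, le_rfl, hWB, hWd, ?_, hWsat⟩
    have h1 : W.size ≤ a₀ := by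
      have : F x.length ≤ a₀ := Finset.le_sup (f := F) (Finset.mem_range.2 hlt)
      exact hWs.trans this
    calc W.size ≤ a₀ := h1
      _ ≤ a₀ + C := Nat.le_add_right _ _
      _ ≤ (a₀ + C) * 2 ^ Nat.nthRoot q x.length + (a₀ + C) := Nat.le_add_left _ _
  · -- long input: the witness circuit of the clause-table verifier
    have hle : n₀ ≤ x.length := (le_max_left _ _).trans hge
    have hNn : N ≤ x.length := (le_max_right _ _).trans hge
    obtain ⟨m', W, y, hWB, hWs, -, hrel, hpre⟩ := hn₀ x hx hle
    dsimp only at hWs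
    rw [hV, clauseTableRel_eq_true_iff hred] at hrel
    obtain ⟨hylen, hsat⟩ := hrel
    set w := succinctWidth c x.length with hw'
    -- the witness circuit has at least `tableExp c n ≥ w` inputs
    have hlenle : y.length ≤ (MetaComplexity.truthTable W.eval).length := hpre.length_le
    rw [MetaComplexity.length_truthTable, hylen] at hlenle
    have hmw : w ≤ m' := by
      have h1 : tableExp c x.length ≤ m' := (Nat.pow_le_pow_iff_right (by norm_num)).1 hlenle
      exact (succinctWidth_le_tableExp c x.length).trans h1
    obtain ⟨W', hW'B, hW's, hW'e⟩ := exists_restrict_inputs hmw W hWB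
    -- the restricted circuit encodes the table's assignment below `2 ^ w`
    have hW'sat : (succinctCNF c cl x).eval W'.assignment = true := by
      rw [eval_succinctCNF_congr hred x (σ := W'.assignment) (τ := tableAssignment y) fun v hv => ?_]
      · exact hsat
      · have hvy : v < y.length := by
          rw [hylen]
          exact hv.trans_le (Nat.pow_le_pow_right Nat.two_pos (succinctWidth_le_tableExp c _))
        have hvt : v < (MetaComplexity.truthTable W.eval).length := by
          rw [MetaComplexity.length_truthTable]
          exact hv.trans_le (Nat.pow_le_pow_right Nat.two_pos hmw)
        rw [Circuit.assignment_of_lt W' hv, hW'e v hv, ← getElem_truthTable W hvt]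
        rw [tableAssignment, decide_eq_true hvy, Bool.true_and, List.getD_eq_getElem _ _ hvy]
        exact (hpre.getElem hvy).symm
    -- its `ACC` simulation
    obtain ⟨W'', hW''B, hW''d, hW''s, hW''e⟩ := hS w W' hW'B
    refine ⟨w, W'', le_rfl, hW''B, hW''d, ?_, ?_⟩
    · -- size `≤ C (w + 2^{⌊n^{1/(2q)}⌋} + 2)^D + C ≤ C 2^{⌊n^{1/q}⌋} + C`
      have h1 : w + W'.size ≤ w + 2 ^ Nat.nthRoot (2 * q) x.length + 2 := by
        have := hW's.trans (Nat.add_le_add_right hWs 2)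
        omega
      calc W''.size ≤ qS.eval (w + W'.size) := hW''s
        _ ≤ qS.eval (w + 2 ^ Nat.nthRoot (2 * q) x.length + 2) := natPoly_eval_mono qS h1
        _ ≤ C * (w + 2 ^ Nat.nthRoot (2 * q) x.length + 2) ^ D + C := hCD _
        _ ≤ C * 2 ^ Nat.nthRoot q x.length + C := hN x.length hNn
        _ ≤ (a₀ + C) * 2 ^ Nat.nthRoot q x.length + (a₀ + C) :=
            Nat.add_le_add (Nat.mul_le_mul_right _ (Nat.le_add_left _ _)) (Nat.le_add_left _ _)
    · rwa [Circuit.assignment_congr hW''e]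

/-! ### The headline over Williams' proved generator and the machine `B` -/

/-- **`NQP ⊄ ACC⁰` from the easy witness lemma, Fact 3.1, Williams' machine `B` at
subexponential witness size and Theorem 4.1.** Hypotheses: `hEWL` — Murray–Williams' Lemma 1.3
at the tree's levels (verbatim as in `MurrayWilliams2018_thm_1_2_acc_of_EWL_of_expSimulation`);
`h31` — Williams 2014, Fact 3.1 (named fact `Williams2014_fact_3_1`); `hB` — Williams' machine
`B` (J. ACM 2014, proof of Thm. 3.2, pp. 12–13) for SUBEXPONENTIAL witnesses: given a succinct
reduction `cl` (constant `c`) of `L`, a modulus `m ≥ 2`, generated clause circuits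
(`NGenerates williamsBound (GoodClauseCircuits c cl m dG eG)`, the output of Lemma 3.1) and
`AC⁰[m]`-SAT algorithms for `2^{⌊w^{1/r}⌋}`-size circuits in time `O(2^{w - ⌊w^{1/r}⌋})` at
every depth (`AccSatSubexp`), `B` names a root `q ≥ 1` such that, if every `x ∈ L` has a
satisfying assignment of `succinctCNF c cl x` encoded by an `accBasis m`-circuit of depth `≤ dW`,
`≤ succinctWidth c |x|` inputs and `≤ a · 2^{⌊|x|^{1/q}⌋} + a` gates, then
`L ∈ NTIME(n + 2ⁿ/n)`; `hW` — Williams 2014, Thm. 4.1 (named fact `Williams2014_thm_4_1`).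
Everything else is a theorem of the tree: Lemma 5.1 (`exists_accSimulation_of_P_subset_ACC0`),
Lemma 3.1 (`Williams2014_lemma_3_1_holds`), Thm. 5.1 from Thm. 4.1
(`MurrayWilliams2018_thm_5_1_of_thm_4_1`, `Williams2014_accSat_polysize_of_thm_4_1`), the
nondeterministic time hierarchy (`exists_mem_NTIME_two_pow_not_mem_williamsBound`), the
subexponential pad (`padLangQ_mem_NTIME_level`, `HasWitnessCircuits.of_padLangQ`,
`eventually_log_padLenQ_pow_le`) and the conversion of witnesses
(`exists_subexpAccAssignments_of_hasWitnessCircuits`).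
[cite: MurrayWilliams2018, §1.1 and Thm. 1.2–1.3 (proofs, §5); Williams2014, proof of Thm. 3.2 and of Thm. 1.1] -/
theorem MurrayWilliams2018_NQP_not_subset_ACC0_of_EWL_of_machineB
    (hEWL : ∀ k : ℕ, 1 ≤ k →
      (∀ e : ℕ, 1 ≤ e → ∀ L ∈ NTIME (fun n => n ^ Nat.log 2 n ^ e),
          ∀ᶠ n in atTop, L.circuitSize n ≤ 2 ^ Nat.log 2 n ^ k) →
        ∃ K e₀ : ℕ, 1 ≤ K ∧ ∀ e : ℕ, e₀ ≤ e →
          NTIMEHasWitnessCircuits (fun n => n ^ Nat.log 2 n ^ e) (fun n => 2 ^ Nat.log 2 n ^ K))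
    (h31 : Williams2014_fact_3_1)
    (hB : ∀ (c : ℕ) (L : Language Bool) (cl : List Bool → ℕ → Clause ℕ) (m dG eG dW : ℕ),
      IsSuccinctReduction c L cl → 2 ≤ m →
      NGenerates williamsBound (GoodClauseCircuits c cl m dG eG) →
      (∀ d' : ℕ, ∃ r : ℕ, 2 ≤ r ∧ AccSatSubexp d' m r) →
      ∃ q : ℕ, 1 ≤ q ∧
        ((∃ a : ℕ, ∀ x ∈ L, ∃ (k : ℕ) (W : Circuit (Fin k)), k ≤ succinctWidth c x.length ∧
            W.IsOver (accBasis m) ∧ W.acDepth ≤ dW ∧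
            W.size ≤ a * 2 ^ Nat.nthRoot q x.length + a ∧
            (succinctCNF c cl x).eval W.assignment = true) →
          L ∈ NTIME williamsBound))
    (hW : Williams2014_thm_4_1) :
    MurrayWilliams2018_NQP_not_subset_ACC0 := by
  intro hsub
  -- `P ⊆ ACC0`: one modulus, one depth, one polynomial for all unrestricted circuits (Lemma 5.1)
  have hP : Classes.P ⊆ ACC0 := P_subset_NQP.trans hsub
  obtain ⟨m, hm, d, qS, hS⟩ := exists_accSimulation_of_P_subset_ACC0 hP
  -- (i) every level has unrestricted circuits of size `2^{(log₂ n)^5}` almost everywhere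
  have hSIZE : ∀ e : ℕ, 1 ≤ e → ∀ L ∈ NTIME (fun n => n ^ Nat.log 2 n ^ e),
      ∀ᶠ n in atTop, L.circuitSize n ≤ 2 ^ Nat.log 2 n ^ (3 + 2) := by
    intro e _ L hL
    have hLP : L ∈ PPoly := ACC0_subset_PPoly (hsub (NTIME_pow_log_pow_subset_NQP e hL))
    obtain ⟨p, hp⟩ := Set.mem_iUnion.1 (hS.PPoly_subset hLP)
    obtain ⟨c, hc⟩ := natPoly_exists_eval_le_pow_log p
    have hc' : ∀ n, p.eval n ≤ 4 * c * 2 ^ Nat.log 2 n ^ (1 + 2) + 4 * c := fun n =>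
      (hc n).trans (by simpa only [pow_one] using mul_pow_pow_log_add_le c 1 n)
    exact eventually_circuitSize_le_of_mem_depthSizeClass hm
      (DepthSizeClass_mono le_rfl (fun _ => le_rfl) hc' hp)
  -- (ii) witness circuits at all high levels (Lemma 1.3)
  obtain ⟨K, e₀, hK1, he₀⟩ := hEWL 5 (by norm_num) hSIZE
  -- (iii) Williams' hard language at the exponential level, its succinct reduction, its generator
  obtain ⟨L₁, hL₁, hL₁w⟩ := exists_mem_NTIME_two_pow_not_mem_williamsBound
  obtain ⟨c, hc⟩ := h31
  obtain ⟨cl, hred⟩ := hc L₁ hL₁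
  obtain ⟨k₃, hk₃⟩ := Williams2014_lemma_3_1_holds c
  have hsatpoly : ∀ d' e : ℕ,
      AccSatInTime d' m (fun n => n ^ e + e) (fun n => 2 ^ n / n ^ k₃) := fun d' e =>
    (Williams2014_accSat_polysize_of_thm_4_1 hW d' m e hm).two_pow_div_pow_of_log_sq k₃
  obtain ⟨dG, eG, hgen⟩ := hk₃ L₁ cl m d hred hm hS.pHasAccCircuits hsatpoly
  -- (iv) the `AC⁰[m]`-SAT algorithms at every depth (Thm. 5.1 from Thm. 4.1); `B` names `q`
  have hsat : ∀ d' : ℕ, ∃ r : ℕ, 2 ≤ r ∧ AccSatSubexp d' m r := fun d' =>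
    MurrayWilliams2018_thm_5_1_of_thm_4_1 hW d' m hm
  obtain ⟨q, hq, hBq⟩ := hB c L₁ cl m dG eG d hred hm hgen hsat
  -- (v) the pad: root `Q = 2q`, parameter `q' = 2KQ`, level `e = max e₀ (6 q')`
  have hQ : 1 ≤ 2 * q := by omega
  have hq'0 : 2 * K * (2 * q) ≠ 0 := by positivity
  obtain ⟨e, he⟩ : ∃ e : ℕ, e = max e₀ (6 * (2 * K * (2 * q))) := ⟨_, rfl⟩
  have he6 : 2 * 3 * (2 * K * (2 * q)) ≤ e + 1 := by omega
  have he2 : 2 * 1 * (2 * K * (2 * q)) ≤ e + 1 := by omega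
  have he1 : 1 ≤ e := by omega
  have hL₁' : L₁ ∈ NTIME (fun n => 2 ^ (n ^ 1)) := by simpa only [pow_one] using hL₁
  have hpad : padLangQ (2 * K * (2 * q)) L₁ ∈ NTIME (fun n => n ^ Nat.log 2 n ^ e) :=
    padLangQ_mem_NTIME_level le_rfl he2 he1 hL₁'
  -- (vi) witness circuits at the level `e`, back to the `2^{n³}`-verifiers of `L₁`
  have hw : HasWitnessCircuits (fun n => n ^ Nat.log 2 n ^ e) (padLangQ (2 * K * (2 * q)) L₁)
      (fun n => 2 ^ Nat.log 2 n ^ K) := he₀ e (he ▸ le_max_left _ _) _ hpad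
  have hw3 := hw.of_padLangQ (j := 3) (by norm_num) hq'0 he6 he1
  have hw3' : HasWitnessCircuits (fun n => 2 ^ (n ^ 3)) L₁
      (fun n => 2 ^ Nat.nthRoot (2 * q) n) :=
    hw3.mono ((eventually_log_padLenQ_pow_le hK1 hQ).mono fun N hN =>
      Nat.pow_le_pow_right two_pos hN)
  -- (vii) subexponential `ACC` assignments for every input; the machine `B` concludes
  exact hL₁w (hBq (exists_subexpAccAssignments_of_hasWitnessCircuits hred hS hq hw3'))

/-- **The headline over named facts and the machine `B` only**: `MurrayWilliams2018_lemma_4_1_ae`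
(Easy Witness Lemma 4.1, a.e. form; Lemma 1.3 by `MurrayWilliams2018_lemma_1_3_of_lemma_4_1_ae`),
`Williams2014_fact_3_1`, Williams' machine `B` at subexponential witness size (`hB`) and
`Williams2014_thm_4_1` imply `¬ (NQP ⊆ ACC0)`. [cite: MurrayWilliams2018, §1.1 and Thm. 1.3] -/
theorem MurrayWilliams2018_NQP_not_subset_ACC0_of_lemma_4_1_ae_of_machineB
    (h41 : MurrayWilliams2018_lemma_4_1_ae) (h31 : Williams2014_fact_3_1)
    (hB : ∀ (c : ℕ) (L : Language Bool) (cl : List Bool → ℕ → Clause ℕ) (m dG eG dW : ℕ),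
      IsSuccinctReduction c L cl → 2 ≤ m →
      NGenerates williamsBound (GoodClauseCircuits c cl m dG eG) →
      (∀ d' : ℕ, ∃ r : ℕ, 2 ≤ r ∧ AccSatSubexp d' m r) →
      ∃ q : ℕ, 1 ≤ q ∧
        ((∃ a : ℕ, ∀ x ∈ L, ∃ (k : ℕ) (W : Circuit (Fin k)), k ≤ succinctWidth c x.length ∧
            W.IsOver (accBasis m) ∧ W.acDepth ≤ dW ∧
            W.size ≤ a * 2 ^ Nat.nthRoot q x.length + a ∧
            (succinctCNF c cl x).eval W.assignment = true) →
          L ∈ NTIME williamsBound))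
    (hW : Williams2014_thm_4_1) : MurrayWilliams2018_NQP_not_subset_ACC0 :=
  MurrayWilliams2018_NQP_not_subset_ACC0_of_EWL_of_machineB
    (MurrayWilliams2018_lemma_1_3_of_lemma_4_1_ae h41) h31 hB hW

end Literature.Computability.Complexity

end
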